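import Summits.SmoothPoincare4.SmoothPoincare4.Theorems.CylinderEntropyCylinderRungTwoZonalMassAndFirstMoment
import Summits.SmoothPoincare4.SmoothPoincare4.Theorems.CylinderEntropyCylinderRungTwoHeatSmoothingLargeTime
import Literature.Geometry.Riemannian.SphericalCylinderEntropy
import HarnessLib

/-!
# Route `CylinderEntropy`, crux `CylinderRungTwo` (stmt-SmoothPoincare4-7631), line `killing-flux`:
# the zonal smoothing on `S⁴` is an approximate identity as `t → 0⁺`, uniformly
# (registered helper `helper_heatSmoothingSmallTime`, step S3d of the area-quantization plan r10)

For the typed zonal heat-kernel series `𝔥(t, s) = zonal t s` of the round `S⁴`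
(`Literature.Geometry.Riemannian.SphericalCylinderEntropy`), a continuous `g : ℝ⁵ → ℝ` and
`ε > 0`, there is `t₀ > 0` such that for all `0 < t ≤ t₀` and all unit vectors `x ∈ ℝ⁵`

  `|∫_{S⁴} 𝔥(t, ∑ᵢ xᵢyᵢ) g(y) dμH⁴(y) - μH⁴(S⁴) g(x)| ≤ ε`.

Proof (elementary, from the landed mass and first moment).  Write `V = μH⁴(S⁴)` and
`s = ∑ᵢ xᵢyᵢ`.  By the MASS identity `∫_{S⁴} 𝔥(t, s) dμH⁴ = V`
(`helper_zonalMassAndFirstMoment`) the difference is `∫_{S⁴} 𝔥(t, s) (g(y) - g(x)) dμH⁴(y)`.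
The function `g` is bounded by `G` and uniformly continuous on the compact sphere: `|g y - g x| ≤ ε'`
once `‖y - x‖ ≤ δ`; otherwise `|g y - g x| ≤ 2G ≤ 2G ‖y - x‖² / δ²`.  On the sphere
`‖y - x‖² = 2(1 - s)`, so in all cases `|g y - g x| ≤ ε' + K (1 - s)` with `K = 4G/δ²`.  Since
`𝔥(t, s) ≥ 0` for `|s| ≤ 1` (`zonal_nonneg`, positivity of the heat kernel),

  `|∫ 𝔥 (g(y) - g(x))| ≤ ∫ 𝔥 (ε' + K (1 - s)) = ε' V + K (V - e^{-4t} V)`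

by the MASS and FIRST MOMENT identities, and `1 - e^{-4t} ≤ 4t`; choosing `ε' V ≤ ε/2` and
`t₀` with `4 K V t₀ ≤ ε/2` finishes the proof.

* `HeatSmoothingSmallTime.norm_eq_one_of_sum_sq`, `HeatSmoothingSmallTime.norm_sub_sq_eq` — unit
  vectors lie on the sphere, and `‖y - x‖² = 2(1 - ∑ xᵢyᵢ)` there;
* `HeatSmoothingSmallTime.abs_sub_le_of_uniform` — the pointwise bound
  `|g y - g x| ≤ ε' + K (1 - s)`;
* `HeatSmoothingSmallTime.one_sub_exp_neg_le` — `1 - e^{-4t} ≤ 4t`;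
* `helper_heatSmoothingSmallTime` — the registered helper, verbatim.

Everything here is PROVED (no `sorry`, no new definitions, no named facts).

References: the statement is the `t → 0⁺` half of the heat-semigroup argument on `S⁴`
(E. B. Davies, *Heat kernels and spectral theory* (1989), Ch. 5, for context only); positivity of
the kernel is the landed `SphericalZonalKernelSeries.zonal_nonneg`.
-/

noncomputable section

-- the prescribed namespace `Summit.SmoothPoincare4.SmoothPoincare4.…` repeats `SmoothPoincare4`
set_option linter.dupNamespace false

open MeasureTheory Set Filter
open scoped ENNReal NNReal Topology BigOperators

namespace Summit.SmoothPoincare4.SmoothPoincare4.Cruxes.CylinderRungTwo.KillingFlux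

open Literature.Geometry.Riemannian.SphericalCylinderEntropy (zonal hausdorffMeasure_sphere_four_lt_top)
open Literature.Geometry.Riemannian.SphericalZonalKernelSeries (zonal_nonneg continuous_zonal)
open HeatSmoothingLargeTime (abs_sum_mul_le_one sum_sq_eq_one_of_mem_sphere)

namespace HeatSmoothingSmallTime

/-- A vector of `ℝ⁵` with `∑ᵢ xᵢ² = 1` has norm `1`. [folklore] -/
theorem norm_eq_one_of_sum_sq {x : EuclideanSpace ℝ (Fin 5)} (hx : ∑ i : Fin 5, x i ^ 2 = 1) :
    ‖x‖ = 1 := by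
  have h := EuclideanSpace.real_norm_sq_eq x
  rw [hx] at h
  exact (pow_eq_one_iff_of_nonneg (norm_nonneg x) two_ne_zero).1 h

/-- On the sphere, `‖y - x‖² = 2 (1 - ∑ᵢ xᵢyᵢ)` for a unit `x`. [folklore] -/
theorem norm_sub_sq_eq {x y : EuclideanSpace ℝ (Fin 5)} (hx : ∑ i : Fin 5, x i ^ 2 = 1)
    (hy : y ∈ Metric.sphere (0 : EuclideanSpace ℝ (Fin 5)) 1) :
    ‖y - x‖ ^ 2 = 2 * (1 - ∑ i : Fin 5, x i * y i) := by
  rw [EuclideanSpace.real_norm_sq_eq]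
  have hy2 := sum_sq_eq_one_of_mem_sphere hy
  simp only [PiLp.sub_apply, Fin.sum_univ_five] at hx hy2 ⊢
  linear_combination hy2 + hx

/-- **The pointwise bound.** If `|g| ≤ G` on the sphere and `|g y - g x| ≤ ε'` whenever
`dist y x ≤ δ` there, then for a unit `x` and `y ∈ S⁴`:
`|g y - g x| ≤ ε' + (4G/δ²) (1 - ∑ᵢ xᵢyᵢ)` (near points by uniform continuity, far points by
`2G ≤ 2G ‖y - x‖²/δ² = (4G/δ²)(1 - s)`). [folklore] -/
theorem abs_sub_le_of_uniform {g : EuclideanSpace ℝ (Fin 5) → ℝ} {G ε' δ : ℝ} (hG0 : 0 ≤ G)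
    (hε' : 0 ≤ ε') (hδ : 0 < δ)
    (hG : ∀ y ∈ Metric.sphere (0 : EuclideanSpace ℝ (Fin 5)) 1, |g y| ≤ G)
    (hU : ∀ y ∈ Metric.sphere (0 : EuclideanSpace ℝ (Fin 5)) 1,
      ∀ x ∈ Metric.sphere (0 : EuclideanSpace ℝ (Fin 5)) 1, dist y x ≤ δ → |g y - g x| ≤ ε')
    {x y : EuclideanSpace ℝ (Fin 5)} (hx : ∑ i : Fin 5, x i ^ 2 = 1)
    (hy : y ∈ Metric.sphere (0 : EuclideanSpace ℝ (Fin 5)) 1) :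
    |g y - g x| ≤ ε' + 4 * G / δ ^ 2 * (1 - ∑ i : Fin 5, x i * y i) := by
  have hxS : x ∈ Metric.sphere (0 : EuclideanSpace ℝ (Fin 5)) 1 :=
    mem_sphere_zero_iff_norm.2 (norm_eq_one_of_sum_sq hx)
  have hsq := norm_sub_sq_eq hx hy
  have h1s : 0 ≤ 1 - ∑ i : Fin 5, x i * y i := by nlinarith [sq_nonneg ‖y - x‖]
  have hK0 : 0 ≤ 4 * G / δ ^ 2 * (1 - ∑ i : Fin 5, x i * y i) := by positivity
  by_cases hd : dist y x ≤ δ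
  · exact (hU y hy x hxS hd).trans (by linarith)
  · have hd' : δ < ‖y - x‖ := by rw [← dist_eq_norm]; exact not_le.1 hd
    have hδ2 : δ ^ 2 ≤ 2 * (1 - ∑ i : Fin 5, x i * y i) := by
      rw [← hsq]
      exact pow_le_pow_left₀ hδ.le hd'.le 2
    have habs : |g y - g x| ≤ 2 * G :=
      (abs_sub _ _).trans (by linarith [hG y hy, hG x hxS])
    have hK1 : 2 * G ≤ 4 * G / δ ^ 2 * (1 - ∑ i : Fin 5, x i * y i) := by
      rw [div_mul_eq_mul_div, le_div_iff₀ (by positivity)]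
      nlinarith
    linarith

/-- `1 - e^{-4t} ≤ 4t` (convexity: `1 + u ≤ eᵘ`). [folklore] -/
theorem one_sub_exp_neg_le (t : ℝ) : 1 - Real.exp (-4 * t) ≤ 4 * t := by
  linarith [Real.add_one_le_exp (-4 * t)]

end HeatSmoothingSmallTime

open HeatSmoothingSmallTime

/-- **Registered helper `helper_heatSmoothingSmallTime` of line `killing-flux` (step S3d of the
area-quantization plan: the zonal smoothing on `S⁴` is an approximate identity as `t → 0⁺`,
uniformly in the centre).** For `g : ℝ⁵ → ℝ` continuous and `ε > 0` there is `t₀ > 0` with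
`|∫_{S⁴} 𝔥(t, ∑ᵢ xᵢyᵢ) g(y) dμH⁴ - μH⁴(S⁴) g(x)| ≤ ε` for all `0 < t ≤ t₀` and unit `x`:
MASS turns the difference into `∫ 𝔥 (g(y) - g(x))`, the kernel is non-negative, `g` is bounded and
uniformly continuous on the compact sphere, `|g y - g x| ≤ ε' + K(1 - s)`, and the FIRST MOMENT
gives `∫ 𝔥 (1 - s) = V (1 - e^{-4t}) ≤ 4Vt`. [folklore] -/
theorem helper_heatSmoothingSmallTime : ∀ g : EuclideanSpace ℝ (Fin 5) → ℝ, Continuous g → ∀ ε : ℝ, 0 < ε → ∃ t₀ : ℝ, 0 < t₀ ∧ ∀ t : ℝ, 0 < t → t ≤ t₀ → ∀ x : EuclideanSpace ℝ (Fin 5), ∑ i : Fin 5, x i ^ 2 = 1 → |(∫ y in Metric.sphere (0 : EuclideanSpace ℝ (Fin 5)) 1, Literature.Geometry.Riemannian.SphericalCylinderEntropy.zonal t (∑ i : Fin 5, x i * y i) * g y ∂(μH[4] : Measure (EuclideanSpace ℝ (Fin 5)))) - (μH[4] (Metric.sphere (0 : EuclideanSpace ℝ (Fin 5)) 1)).toReal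 * g x| ≤ ε := by
  intro g hg ε hε
  -- the sphere: compact, measurable, of finite `μH⁴`-measure
  have hSc : IsCompact (Metric.sphere (0 : EuclideanSpace ℝ (Fin 5)) 1) := isCompact_sphere _ _
  have hSm : MeasurableSet (Metric.sphere (0 : EuclideanSpace ℝ (Fin 5)) 1) :=
    Metric.isClosed_sphere.measurableSet
  have hSlt : (μH[4] : Measure (EuclideanSpace ℝ (Fin 5)))
      (Metric.sphere (0 : EuclideanSpace ℝ (Fin 5)) 1) < ⊤ := hausdorffMeasure_sphere_four_lt_top
  set V : ℝ := ((μH[4] : Measure (EuclideanSpace ℝ (Fin 5)))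
    (Metric.sphere (0 : EuclideanSpace ℝ (Fin 5)) 1)).toReal with hV
  have hV0 : 0 ≤ V := ENNReal.toReal_nonneg
  have hV1 : 0 < V + 1 := by linarith
  -- `g` is bounded on the sphere
  obtain ⟨G₀, hG₀⟩ := hSc.exists_bound_of_continuousOn hg.continuousOn
  set G : ℝ := max G₀ 0 with hGdef
  have hG0 : 0 ≤ G := le_max_right _ _
  have hG : ∀ y ∈ Metric.sphere (0 : EuclideanSpace ℝ (Fin 5)) 1, |g y| ≤ G := fun y hy =>
    ((Real.norm_eq_abs _).symm.le.trans (hG₀ y hy)).trans (le_max_left _ _)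
  -- `g` is uniformly continuous on the sphere
  set ε' : ℝ := ε / 2 / (V + 1) with hε'
  have hε'0 : 0 < ε' := div_pos (half_pos hε) hV1
  have hε'V : ε' * V ≤ ε / 2 :=
    calc ε' * V ≤ ε' * (V + 1) := mul_le_mul_of_nonneg_left (by linarith) hε'0.le
      _ = ε / 2 := div_mul_cancel₀ _ hV1.ne'
  obtain ⟨δ, hδ0, hδ⟩ := Metric.uniformContinuousOn_iff_le.1
    (hSc.uniformContinuousOn_of_continuous hg.continuousOn) ε' hε'0
  have hU : ∀ y ∈ Metric.sphere (0 : EuclideanSpace ℝ (Fin 5)) 1,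
      ∀ x ∈ Metric.sphere (0 : EuclideanSpace ℝ (Fin 5)) 1, dist y x ≤ δ → |g y - g x| ≤ ε' :=
    fun y hy x hx hd => by
      have h := hδ y hy x hx hd
      rwa [Real.dist_eq] at h
  -- the constant of the pointwise bound and the time threshold
  set K : ℝ := 4 * G / δ ^ 2 with hK
  have hK0 : 0 ≤ K := by positivity
  have hKV : 0 ≤ K * V := mul_nonneg hK0 hV0
  have h4KV : 0 < 4 * K * V + 1 := by linarith
  set t₀ : ℝ := ε / 2 / (4 * K * V + 1) with ht₀
  have ht₀0 : 0 < t₀ := div_pos (half_pos hε) h4KV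
  have ht₀K : K * V * (4 * t₀) ≤ ε / 2 := by
    have h : t₀ * (4 * K * V + 1) = ε / 2 := div_mul_cancel₀ _ h4KV.ne'
    nlinarith
  refine ⟨t₀, ht₀0, fun t ht htt₀ x hx => ?_⟩
  -- mass and first moment of the kernel centred at `x`
  obtain ⟨hmass, hfirst⟩ := helper_zonalMassAndFirstMoment t ht x hx
  have hxn : ‖x‖ = 1 := norm_eq_one_of_sum_sq hx
  -- the kernel is non-negative on the sphere
  have hZ0 : ∀ y ∈ Metric.sphere (0 : EuclideanSpace ℝ (Fin 5)) 1,
      0 ≤ zonal t (∑ i : Fin 5, x i * y i) := fun y hy =>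
    zonal_nonneg ht _ (abs_le.1 (abs_sum_mul_le_one hxn.le hy))
  -- continuity and integrability of the pieces
  have hsc : Continuous fun y : EuclideanSpace ℝ (Fin 5) => ∑ i : Fin 5, x i * y i := by fun_prop
  have hZc : Continuous fun y : EuclideanSpace ℝ (Fin 5) => zonal t (∑ i : Fin 5, x i * y i) :=
    (continuous_zonal ht).comp hsc
  have hint : ∀ {F : EuclideanSpace ℝ (Fin 5) → ℝ}, Continuous F →
      IntegrableOn F (Metric.sphere (0 : EuclideanSpace ℝ (Fin 5)) 1)
        (μH[4] : Measure (EuclideanSpace ℝ (Fin 5))) := fun hF =>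
    hF.continuousOn.integrableOn_of_subset_isCompact hSc hSm Subset.rfl hSlt.ne
  have hiZg : IntegrableOn (fun y : EuclideanSpace ℝ (Fin 5) => zonal t (∑ i : Fin 5, x i * y i) * g y)
      (Metric.sphere (0 : EuclideanSpace ℝ (Fin 5)) 1) (μH[4] : Measure (EuclideanSpace ℝ (Fin 5))) :=
    hint (hZc.mul hg)
  have hiZ := hint hZc
  have hiZs : IntegrableOn (fun y : EuclideanSpace ℝ (Fin 5) =>
        zonal t (∑ i : Fin 5, x i * y i) * ∑ i : Fin 5, x i * y i)
      (Metric.sphere (0 : EuclideanSpace ℝ (Fin 5)) 1) (μH[4] : Measure (EuclideanSpace ℝ (Fin 5))) :=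
    hint (hZc.mul hsc)
  -- Step 1: the difference is `∫ 𝔥 (g y - g x)` (MASS)
  have hdiff : (∫ y in Metric.sphere (0 : EuclideanSpace ℝ (Fin 5)) 1,
        zonal t (∑ i : Fin 5, x i * y i) * g y ∂(μH[4] : Measure (EuclideanSpace ℝ (Fin 5)))) -
        V * g x =
      ∫ y in Metric.sphere (0 : EuclideanSpace ℝ (Fin 5)) 1,
        zonal t (∑ i : Fin 5, x i * y i) * (g y - g x)
          ∂(μH[4] : Measure (EuclideanSpace ℝ (Fin 5))) := by
    have h2 : ∫ y in Metric.sphere (0 : EuclideanSpace ℝ (Fin 5)) 1,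
        zonal t (∑ i : Fin 5, x i * y i) * g x ∂(μH[4] : Measure (EuclideanSpace ℝ (Fin 5))) =
        V * g x := by
      rw [integral_mul_const, hmass]
    rw [← h2, ← integral_sub hiZg (hiZ.mul_const _)]
    refine integral_congr_ae (ae_of_all _ fun y => ?_)
    ring
  -- Step 2: the pointwise bound of the integrand on the sphere
  have hbound : ∀ᵐ y ∂(μH[4] : Measure (EuclideanSpace ℝ (Fin 5))).restrict
      (Metric.sphere (0 : EuclideanSpace ℝ (Fin 5)) 1),
      ‖zonal t (∑ i : Fin 5, x i * y i) * (g y - g x)‖ ≤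
        (ε' + K) * zonal t (∑ i : Fin 5, x i * y i) -
          K * (zonal t (∑ i : Fin 5, x i * y i) * ∑ i : Fin 5, x i * y i) := by
    refine (ae_restrict_iff' hSm).2 (ae_of_all _ fun y hy => ?_)
    rw [norm_mul, Real.norm_eq_abs, Real.norm_eq_abs, abs_of_nonneg (hZ0 y hy)]
    have h := mul_le_mul_of_nonneg_left (abs_sub_le_of_uniform hG0 hε'0.le hδ0 hG hU hx hy)
      (hZ0 y hy)
    rw [← hK] at h
    linarith
  have hib : IntegrableOn (fun y : EuclideanSpace ℝ (Fin 5) =>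
      (ε' + K) * zonal t (∑ i : Fin 5, x i * y i) -
        K * (zonal t (∑ i : Fin 5, x i * y i) * ∑ i : Fin 5, x i * y i))
      (Metric.sphere (0 : EuclideanSpace ℝ (Fin 5)) 1) (μH[4] : Measure (EuclideanSpace ℝ (Fin 5))) :=
    (hiZ.const_mul _).sub (hiZs.const_mul _)
  have hest := norm_integral_le_of_norm_le hib hbound
  rw [Real.norm_eq_abs] at hest
  -- Step 3: the integral of the bound (MASS and FIRST MOMENT)
  have hval : ∫ y in Metric.sphere (0 : EuclideanSpace ℝ (Fin 5)) 1,
      (ε' + K) * zonal t (∑ i : Fin 5, x i * y i) -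
        K * (zonal t (∑ i : Fin 5, x i * y i) * ∑ i : Fin 5, x i * y i)
        ∂(μH[4] : Measure (EuclideanSpace ℝ (Fin 5))) =
      (ε' + K) * V - K * (Real.exp (-4 * t) * V) := by
    rw [integral_sub (hiZ.const_mul _) (hiZs.const_mul _), integral_const_mul, integral_const_mul,
      hmass, hfirst]
  -- Step 4: assemble
  rw [hdiff]
  refine hest.trans ?_
  rw [hval]
  have h1 : K * V * (1 - Real.exp (-4 * t)) ≤ K * V * (4 * t) :=
    mul_le_mul_of_nonneg_left (one_sub_exp_neg_le t) hKV
  have h2 : K * V * (4 * t) ≤ K * V * (4 * t₀) := mul_le_mul_of_nonneg_left (by linarith) hKV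
  have hrw : (ε' + K) * V - K * (Real.exp (-4 * t) * V) = ε' * V + K * V * (1 - Real.exp (-4 * t)) := by
    ring
  rw [hrw]
  linarith

end Summit.SmoothPoincare4.SmoothPoincare4.Cruxes.CylinderRungTwo.KillingFlux

end
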